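import Literature.Geometry.Lorentzian.LandauLifshitzPseudotensor
import Mathlib.LinearAlgebra.Matrix.Charpoly.Coeff
import Mathlib.Analysis.Calculus.Deriv.Polynomial
import Mathlib.Analysis.Calculus.Deriv.Mul
import Mathlib.Analysis.Calculus.Deriv.Comp
import Mathlib.Analysis.Calculus.Deriv.Add
import Mathlib.Analysis.Calculus.FDeriv.Mul
import HarnessLib

/-!
# Landau–Lifshitz objects as functions of the VALUE of the metric components: first-order
# jet calculus of `det (g_{μν})` and `g^{μν}`

Every pointwise object of `LandauLifshitzPseudotensor.lean` that carries no derivative —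
`gram`, `metricDet`, `upper`, `superpotential` — depends on the field `g` only through its value
`g y`: `gram g y = gram (fun _ ↦ g y) 0` *definitionally*. This file studies these objects as
functions of the value `A : E4 →L[ℝ] E4 →L[ℝ] ℝ`:

* `A ↦ det (A_{μν})` is `C^∞` (Leibniz formula) and its derivative at a nondegenerate `A₀` is
  Jacobi's formula `X ↦ det(A₀) · tr (A₀^{-1} X)` (`fderiv_metricDet_const_apply`), obtained from
  Mathlib's `Matrix.det_one_add_smul` along the line `A₀ + rX`;
* `A ↦ (A_{μν})⁻¹ᵢⱼ` is `C^∞` near a nondegenerate `A₀` (Cramer) with derivative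
  `X ↦ −(A₀⁻¹ X A₀⁻¹)ᵢⱼ` (`fderiv_upper_const_apply`), obtained by differentiating
  `A A⁻¹ = 1` entrywise.

These are the two inputs of the first-order expansion of the Landau–Lifshitz superpotential
`H^{μανβ} = −g (g^{μν}g^{αβ} − g^{αν}g^{μβ})` (LL §96 (96.3)) used in the proof that the
densitised pseudotensor `(−g) t^{μν}_LL` is quadratic in first derivatives (LL (96.8)/(96.9)).

## References
* L. D. Landau, E. M. Lifshitz, *The Classical Theory of Fields*, 4th ed., Pergamon 1975, §96.
  [LandauLifshitz1975]
* R. A. Horn, C. R. Johnson, *Matrix Analysis*, CUP 1985, §0.8.10 (Jacobi's formula). [folklore]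
-/

noncomputable section

set_option maxSynthPendingDepth 3

open Filter Set
open scoped Topology ContDiff Matrix

namespace Literature.Geometry.Lorentzian

namespace LandauLifshitz

/-! ### Dependence on the value only -/

section Value

variable (g : E4 → E4 →L[ℝ] E4 →L[ℝ] ℝ)

/-- `gram g y` depends only on the value `g y`. [folklore] -/
theorem gram_eq_const (y : E4) : gram g y = gram (fun _ : E4 ↦ g y) 0 := rfl

/-- `metricDet g y` depends only on the value `g y`. [folklore] -/
theorem metricDet_eq_const (y : E4) : metricDet g y = metricDet (fun _ : E4 ↦ g y) 0 := rfl

/-- `upper g y` depends only on the value `g y`. [folklore] -/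
theorem upper_eq_const (y : E4) : upper g y = upper (fun _ : E4 ↦ g y) 0 := rfl

/-- `superpotential g y` depends only on the value `g y`. [cite: LandauLifshitz1975, §96 (96.3)] -/
theorem superpotential_eq_const (y : E4) (μ α ν β : Fin 4) :
    superpotential g y μ α ν β = superpotential (fun _ : E4 ↦ g y) 0 μ α ν β := rfl

end Value

/-! ### Linearity of the components in the value -/

section Linear

variable (A B : E4 →L[ℝ] E4 →L[ℝ] ℝ)

/-- The components of a sum. [folklore] -/
theorem gram_const_add :
    gram (fun _ : E4 ↦ A + B) 0 = gram (fun _ : E4 ↦ A) 0 + gram (fun _ : E4 ↦ B) 0 := by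
  ext μ ν; simp

/-- The components of a scalar multiple. [folklore] -/
theorem gram_const_smul (r : ℝ) :
    gram (fun _ : E4 ↦ r • A) 0 = r • gram (fun _ : E4 ↦ A) 0 := by
  ext μ ν; simp

/-- The components along a line `A + rX`. [folklore] -/
theorem gram_const_add_smul (X : E4 →L[ℝ] E4 →L[ℝ] ℝ) (r : ℝ) :
    gram (fun _ : E4 ↦ A + r • X) 0 = gram (fun _ : E4 ↦ A) 0 + r • gram (fun _ : E4 ↦ X) 0 := by
  rw [gram_const_add, gram_const_smul]

/-- Each component `A ↦ A(∂_μ, ∂_ν)` is a continuous linear functional of the value; its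
derivative is itself. [folklore] -/
theorem hasFDerivAt_gram_const (A₀ : E4 →L[ℝ] E4 →L[ℝ] ℝ) (μ ν : Fin 4) :
    HasFDerivAt (fun A : E4 →L[ℝ] E4 →L[ℝ] ℝ ↦ gram (fun _ : E4 ↦ A) 0 μ ν)
      ((ContinuousLinearMap.apply ℝ ℝ (E4.basisVector ν)).comp
        (ContinuousLinearMap.apply ℝ (E4 →L[ℝ] ℝ) (E4.basisVector μ))) A₀ := by
  have h := ((ContinuousLinearMap.apply ℝ ℝ (E4.basisVector ν)).comp
        (ContinuousLinearMap.apply ℝ (E4 →L[ℝ] ℝ) (E4.basisVector μ))).hasFDerivAt (x := A₀)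
  convert h using 1
  ext A
  simp

/-- The components are `C^∞` in the value. [folklore] -/
theorem contDiff_gram_const (μ ν : Fin 4) {n : WithTop ℕ∞} :
    ContDiff ℝ n (fun A : E4 →L[ℝ] E4 →L[ℝ] ℝ ↦ gram (fun _ : E4 ↦ A) 0 μ ν) := by
  have h := ((ContinuousLinearMap.apply ℝ ℝ (E4.basisVector ν)).comp
        (ContinuousLinearMap.apply ℝ (E4 →L[ℝ] ℝ) (E4.basisVector μ))).contDiff (n := n)
  convert h using 1
  ext A
  simp

/-- The derivative of a component in the direction `X` is the component of `X`. [folklore] -/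
theorem fderiv_gram_const_apply (A₀ X : E4 →L[ℝ] E4 →L[ℝ] ℝ) (μ ν : Fin 4) :
    fderiv ℝ (fun A : E4 →L[ℝ] E4 →L[ℝ] ℝ ↦ gram (fun _ : E4 ↦ A) 0 μ ν) A₀ X =
      gram (fun _ : E4 ↦ X) 0 μ ν := by
  rw [(hasFDerivAt_gram_const A₀ μ ν).fderiv]
  simp

end Linear

/-! ### The determinant as a function of the value: smoothness and Jacobi's formula -/

section Det

/-- `A ↦ det (A_{μν})` is `C^∞` (Leibniz formula). [folklore] -/
theorem contDiff_metricDet_const {n : WithTop ℕ∞} :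
    ContDiff ℝ n (fun A : E4 →L[ℝ] E4 →L[ℝ] ℝ ↦ metricDet (fun _ : E4 ↦ A) 0) := by
  unfold metricDet
  simp_rw [Matrix.det_apply']
  exact ContDiff.sum fun σ _ ↦ contDiff_const.mul
    (contDiff_prod fun i _ ↦ contDiff_gram_const _ _)

/-- `A ↦ det (A_{μν})` is differentiable. [folklore] -/
theorem differentiableAt_metricDet_const (A₀ : E4 →L[ℝ] E4 →L[ℝ] ℝ) :
    DifferentiableAt ℝ (fun A : E4 →L[ℝ] E4 →L[ℝ] ℝ ↦ metricDet (fun _ : E4 ↦ A) 0) A₀ :=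
  (contDiff_metricDet_const (n := 1)).contDiffAt.differentiableAt one_ne_zero

/-- **Jacobi's formula** for the determinant of the components: at a nondegenerate value `A₀`,
`D(det ∘ gram)(A₀)(X) = det(A₀) · tr ((A₀)⁻¹ X)` (matrices of components). Proof: along the line
`A₀ + rX`, `det (M₀ + r M_X) = det M₀ · det (1 + r M₀⁻¹ M_X)` and Mathlib's
`Matrix.det_one_add_smul`. [folklore] -/
theorem fderiv_metricDet_const_apply {A₀ : E4 →L[ℝ] E4 →L[ℝ] ℝ}
    (h₀ : metricDet (fun _ : E4 ↦ A₀) 0 ≠ 0) (X : E4 →L[ℝ] E4 →L[ℝ] ℝ) :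
    fderiv ℝ (fun A : E4 →L[ℝ] E4 →L[ℝ] ℝ ↦ metricDet (fun _ : E4 ↦ A) 0) A₀ X =
      metricDet (fun _ : E4 ↦ A₀) 0 *
        Matrix.trace (upper (fun _ : E4 ↦ A₀) 0 * gram (fun _ : E4 ↦ X) 0) := by
  set M₀ : Matrix (Fin 4) (Fin 4) ℝ := gram (fun _ : E4 ↦ A₀) 0 with hM₀
  set MX : Matrix (Fin 4) (Fin 4) ℝ := gram (fun _ : E4 ↦ X) 0 with hMX
  set N : Matrix (Fin 4) (Fin 4) ℝ := M₀⁻¹ * MX with hN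
  have hdet : M₀.det ≠ 0 := h₀
  have hunit : IsUnit M₀.det := isUnit_iff_ne_zero.2 hdet
  -- the function along the line
  set φ : ℝ → ℝ := fun r ↦ metricDet (fun _ : E4 ↦ A₀ + r • X) 0 with hφ
  -- (1) chain rule: `φ' (0) = D(det∘gram)(A₀)(X)`
  have hline : HasDerivAt (fun r : ℝ ↦ A₀ + r • X) X 0 := by
    simpa using ((hasDerivAt_id (0 : ℝ)).smul_const X).const_add A₀
  have h1 : HasDerivAt φ
      (fderiv ℝ (fun A : E4 →L[ℝ] E4 →L[ℝ] ℝ ↦ metricDet (fun _ : E4 ↦ A) 0) A₀ X) 0 := by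
    have hd := (differentiableAt_metricDet_const A₀).hasFDerivAt
    have hd' : HasFDerivAt (fun A : E4 →L[ℝ] E4 →L[ℝ] ℝ ↦ metricDet (fun _ : E4 ↦ A) 0)
        (fderiv ℝ (fun A : E4 →L[ℝ] E4 →L[ℝ] ℝ ↦ metricDet (fun _ : E4 ↦ A) 0) A₀)
        (A₀ + (0 : ℝ) • X) := by simpa using hd
    exact hd'.comp_hasDerivAt (0 : ℝ) hline
  -- (2) explicit form of `φ`
  obtain ⟨p, hp⟩ : ∃ p : ℝ → ℝ, (Differentiable ℝ p) ∧
      ∀ r, φ r = M₀.det * (1 + Matrix.trace N * r + p r * r ^ 2) := by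
    refine ⟨fun r ↦ ((Matrix.det (1 + (Polynomial.X : Polynomial ℝ) •
        N.map Polynomial.C)).divX.divX).eval r, ?_, fun r ↦ ?_⟩
    · exact Polynomial.differentiable _
    · have hgram : gram (fun _ : E4 ↦ A₀ + r • X) 0 = M₀ * (1 + r • N) := by
        rw [gram_const_add_smul, mul_add, mul_one, hN, Matrix.mul_smul, ← Matrix.mul_assoc,
          Matrix.mul_nonsing_inv _ hunit, Matrix.one_mul]
      change (gram (fun _ : E4 ↦ A₀ + r • X) 0).det = _
      rw [hgram, Matrix.det_mul, Matrix.det_one_add_smul]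
  have h2 : HasDerivAt φ (M₀.det * Matrix.trace N) 0 := by
    have hφ' : φ = fun r ↦ M₀.det * (1 + Matrix.trace N * r + p r * r ^ 2) := funext hp.2
    rw [hφ']
    have hpr : HasDerivAt (fun r : ℝ ↦ p r * r ^ 2) 0 0 := by
      have := (hp.1 0).hasDerivAt.fun_mul (hasDerivAt_pow 2 (0 : ℝ))
      simpa using this
    have hlin : HasDerivAt (fun r : ℝ ↦ 1 + Matrix.trace N * r) (Matrix.trace N) 0 := by
      simpa using ((hasDerivAt_id (0 : ℝ)).const_mul (Matrix.trace N)).const_add 1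
    have := (hlin.add hpr).const_mul M₀.det
    simpa using this
  rw [h1.unique h2]
  rfl

end Det

/-! ### The inverse components as a function of the value: smoothness and derivative -/

section Inverse

/-- The adjugate entries `A ↦ adj (A_{μν})ᵢⱼ` are `C^∞`. [folklore] -/
theorem contDiff_adjugate_const (i j : Fin 4) {n : WithTop ℕ∞} :
    ContDiff ℝ n (fun A : E4 →L[ℝ] E4 →L[ℝ] ℝ ↦ (gram (fun _ : E4 ↦ A) 0).adjugate i j) := by
  simp_rw [Matrix.adjugate_apply, Matrix.det_apply']
  refine ContDiff.sum fun σ _ ↦ contDiff_const.mul (contDiff_prod fun k _ ↦ ?_)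
  by_cases h : (σ k : Fin 4) = j
  · simp_rw [Matrix.updateRow_apply, if_pos h]
    exact contDiff_const
  · simp_rw [Matrix.updateRow_apply, if_neg h]
    exact contDiff_gram_const _ _

/-- Cramer's rule for the inverse components: `g^{ij} = (det)⁻¹ adjᵢⱼ`. [folklore] -/
theorem upper_eq_inv_mul_adjugate (g : E4 → E4 →L[ℝ] E4 →L[ℝ] ℝ) (y : E4) (i j : Fin 4) :
    upper g y i j = (metricDet g y)⁻¹ * (gram g y).adjugate i j := by
  rw [upper, Matrix.inv_def, Matrix.smul_apply, smul_eq_mul, Ring.inverse_eq_inv]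
  rfl

/-- **The inverse components are `C^∞` in the value near a nondegenerate value.** [folklore] -/
theorem contDiffAt_upper_const {A₀ : E4 →L[ℝ] E4 →L[ℝ] ℝ}
    (h₀ : metricDet (fun _ : E4 ↦ A₀) 0 ≠ 0) (i j : Fin 4) {n : WithTop ℕ∞} :
    ContDiffAt ℝ n (fun A : E4 →L[ℝ] E4 →L[ℝ] ℝ ↦ upper (fun _ : E4 ↦ A) 0 i j) A₀ := by
  simp_rw [upper_eq_inv_mul_adjugate]
  exact (contDiff_metricDet_const.contDiffAt.inv h₀).mul (contDiff_adjugate_const i j).contDiffAt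

/-- The inverse components are differentiable in the value at a nondegenerate value. [folklore] -/
theorem differentiableAt_upper_const {A₀ : E4 →L[ℝ] E4 →L[ℝ] ℝ}
    (h₀ : metricDet (fun _ : E4 ↦ A₀) 0 ≠ 0) (i j : Fin 4) :
    DifferentiableAt ℝ (fun A : E4 →L[ℝ] E4 →L[ℝ] ℝ ↦ upper (fun _ : E4 ↦ A) 0 i j) A₀ :=
  (contDiffAt_upper_const h₀ i j (n := 1)).differentiableAt one_ne_zero

/-- Nondegeneracy is an open condition on the value. [folklore] -/
theorem eventually_metricDet_const_ne_zero {A₀ : E4 →L[ℝ] E4 →L[ℝ] ℝ}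
    (h₀ : metricDet (fun _ : E4 ↦ A₀) 0 ≠ 0) :
    ∀ᶠ A in 𝓝 A₀, metricDet (fun _ : E4 ↦ A) 0 ≠ 0 :=
  (contDiff_metricDet_const (n := 0)).continuous.continuousAt.eventually_ne h₀

/-- **Derivative of the inverse components**: at a nondegenerate value `A₀`,
`D(g^{ij})(A₀)(X) = −(A₀⁻¹ X A₀⁻¹)ᵢⱼ` (matrices of components), by differentiating
`Σ_κ A_{iκ} A^{κj} = δᵢⱼ`. [folklore] -/
theorem fderiv_upper_const_apply {A₀ : E4 →L[ℝ] E4 →L[ℝ] ℝ}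
    (h₀ : metricDet (fun _ : E4 ↦ A₀) 0 ≠ 0) (X : E4 →L[ℝ] E4 →L[ℝ] ℝ) (i j : Fin 4) :
    fderiv ℝ (fun A : E4 →L[ℝ] E4 →L[ℝ] ℝ ↦ upper (fun _ : E4 ↦ A) 0 i j) A₀ X =
      -(upper (fun _ : E4 ↦ A₀) 0 * gram (fun _ : E4 ↦ X) 0 * upper (fun _ : E4 ↦ A₀) 0) i j := by
  set M₀ : Matrix (Fin 4) (Fin 4) ℝ := gram (fun _ : E4 ↦ A₀) 0 with hM₀
  set U₀ : Matrix (Fin 4) (Fin 4) ℝ := upper (fun _ : E4 ↦ A₀) 0 with hU₀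
  set MX : Matrix (Fin 4) (Fin 4) ℝ := gram (fun _ : E4 ↦ X) 0 with hMX
  have hunit : IsUnit M₀.det := isUnit_iff_ne_zero.2 h₀
  -- the matrix of derivatives of the entries of the inverse, in the direction `X`
  set DU : Matrix (Fin 4) (Fin 4) ℝ :=
    Matrix.of fun κ l ↦ fderiv ℝ (fun A : E4 →L[ℝ] E4 →L[ℝ] ℝ ↦ upper (fun _ : E4 ↦ A) 0 κ l) A₀ X
    with hDU
  -- differentiate `Σ_κ A_{iκ} A^{κl} = δ_{il}` at `A₀` in the direction `X`
  have hrow : ∀ i l : Fin 4, ∑ κ, M₀ i κ * DU κ l = -(∑ κ, MX i κ * U₀ κ l) := by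
    intro i l
    have hconst : (fun A : E4 →L[ℝ] E4 →L[ℝ] ℝ ↦
        ∑ κ, gram (fun _ : E4 ↦ A) 0 i κ * upper (fun _ : E4 ↦ A) 0 κ l) =ᶠ[𝓝 A₀]
        fun _ ↦ (1 : Matrix (Fin 4) (Fin 4) ℝ) i l := by
      filter_upwards [eventually_metricDet_const_ne_zero h₀] with A hA
      have h := Matrix.mul_nonsing_inv (gram (fun _ : E4 ↦ A) 0) (isUnit_iff_ne_zero.2 hA)
      have h' := congr_fun (congr_fun h i) l
      simp only [Matrix.mul_apply] at h'
      exact h'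
    have hzero : fderiv ℝ (fun A : E4 →L[ℝ] E4 →L[ℝ] ℝ ↦
        ∑ κ, gram (fun _ : E4 ↦ A) 0 i κ * upper (fun _ : E4 ↦ A) 0 κ l) A₀ X = 0 := by
      rw [hconst.fderiv_eq, fderiv_const_apply]
      rfl
    have hsum : HasFDerivAt (fun A : E4 →L[ℝ] E4 →L[ℝ] ℝ ↦
        ∑ κ, gram (fun _ : E4 ↦ A) 0 i κ * upper (fun _ : E4 ↦ A) 0 κ l)
        (∑ κ, (gram (fun _ : E4 ↦ A₀) 0 i κ •
            fderiv ℝ (fun A : E4 →L[ℝ] E4 →L[ℝ] ℝ ↦ upper (fun _ : E4 ↦ A) 0 κ l) A₀ +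
          upper (fun _ : E4 ↦ A₀) 0 κ l •
            (ContinuousLinearMap.apply ℝ ℝ (E4.basisVector κ)).comp
              (ContinuousLinearMap.apply ℝ (E4 →L[ℝ] ℝ) (E4.basisVector i)))) A₀ := by
      refine HasFDerivAt.fun_sum fun κ _ ↦ ?_
      exact (hasFDerivAt_gram_const A₀ i κ).mul (differentiableAt_upper_const h₀ κ l).hasFDerivAt
    rw [hsum.fderiv] at hzero
    simp only [_root_.sum_apply, _root_.add_apply, _root_.smul_apply,
      ContinuousLinearMap.coe_comp, Function.comp_apply, ContinuousLinearMap.apply_apply,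
      smul_eq_mul] at hzero
    have hsplit : ∑ κ, M₀ i κ * DU κ l + ∑ κ, MX i κ * U₀ κ l = 0 := by
      rw [← Finset.sum_add_distrib, ← hzero]
      refine Finset.sum_congr rfl fun κ _ ↦ ?_
      simp only [hM₀, hDU, hMX, hU₀, Matrix.of_apply, gram_apply]
      ring
    linarith
  have hmat : M₀ * DU = -(MX * U₀) := by
    ext i l
    simp only [Matrix.mul_apply, Matrix.neg_apply]
    exact hrow i l
  have hUM : U₀ * M₀ = 1 := Matrix.nonsing_inv_mul M₀ hunit
  have hDUeq : DU = -(U₀ * MX * U₀) := by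
    calc DU = U₀ * M₀ * DU := by rw [hUM, Matrix.one_mul]
      _ = U₀ * (M₀ * DU) := by rw [Matrix.mul_assoc]
      _ = -(U₀ * MX * U₀) := by rw [hmat, Matrix.mul_neg, Matrix.mul_assoc]
  have := congr_fun (congr_fun hDUeq i) j
  simpa only [hDU, Matrix.of_apply, Matrix.neg_apply] using this

end Inverse

/-! ### The superpotential as a function of the value: smoothness and first derivative -/

section Superpotential

/-- The superpotential `A ↦ H^{μανβ}(A) = −det(A_{..})(A^{μν}A^{αβ} − A^{αν}A^{μβ})` is `C^∞`
in the value near a nondegenerate value. [cite: LandauLifshitz1975, §96 (96.3)] -/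
theorem contDiffAt_superpotential_const {A₀ : E4 →L[ℝ] E4 →L[ℝ] ℝ}
    (h₀ : metricDet (fun _ : E4 ↦ A₀) 0 ≠ 0) (μ α ν β : Fin 4) {n : WithTop ℕ∞} :
    ContDiffAt ℝ n (fun A : E4 →L[ℝ] E4 →L[ℝ] ℝ ↦ superpotential (fun _ : E4 ↦ A) 0 μ α ν β) A₀ := by
  unfold superpotential
  exact contDiff_metricDet_const.contDiffAt.neg.mul
    (((contDiffAt_upper_const h₀ μ ν).mul (contDiffAt_upper_const h₀ α β)).sub
      ((contDiffAt_upper_const h₀ α ν).mul (contDiffAt_upper_const h₀ μ β)))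

/-- The superpotential is differentiable in the value at a nondegenerate value.
[cite: LandauLifshitz1975, §96 (96.3)] -/
theorem differentiableAt_superpotential_const {A₀ : E4 →L[ℝ] E4 →L[ℝ] ℝ}
    (h₀ : metricDet (fun _ : E4 ↦ A₀) 0 ≠ 0) (μ α ν β : Fin 4) :
    DifferentiableAt ℝ
      (fun A : E4 →L[ℝ] E4 →L[ℝ] ℝ ↦ superpotential (fun _ : E4 ↦ A) 0 μ α ν β) A₀ :=
  (contDiffAt_superpotential_const h₀ μ α ν β (n := 1)).differentiableAt one_ne_zero

/-- **First-order expansion of the superpotential in the value** (LL §96: the variation of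
`H^{μανβ} = −g(g^{μν}g^{αβ} − g^{αν}g^{μβ})` under `δg_{ρσ} = X_{ρσ}`): with `M₀ = (A₀)_{..}`,
`U₀ = M₀⁻¹`, `d₀ = det M₀` and `M_X` the components of `X`,
`DH^{μανβ}(A₀)(X) = −d₀ tr(U₀M_X)(U₀^{μν}U₀^{αβ} − U₀^{αν}U₀^{μβ})
  + d₀((U₀M_XU₀)^{μν}U₀^{αβ} + U₀^{μν}(U₀M_XU₀)^{αβ} − (U₀M_XU₀)^{αν}U₀^{μβ} − U₀^{αν}(U₀M_XU₀)^{μβ})`.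
[cite: LandauLifshitz1975, §96 (96.3)] -/
theorem fderiv_superpotential_const_apply {A₀ : E4 →L[ℝ] E4 →L[ℝ] ℝ}
    (h₀ : metricDet (fun _ : E4 ↦ A₀) 0 ≠ 0) (X : E4 →L[ℝ] E4 →L[ℝ] ℝ) (μ α ν β : Fin 4) :
    fderiv ℝ (fun A : E4 →L[ℝ] E4 →L[ℝ] ℝ ↦ superpotential (fun _ : E4 ↦ A) 0 μ α ν β) A₀ X =
      -(metricDet (fun _ : E4 ↦ A₀) 0 *
          Matrix.trace (upper (fun _ : E4 ↦ A₀) 0 * gram (fun _ : E4 ↦ X) 0)) *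
        (upper (fun _ : E4 ↦ A₀) 0 μ ν * upper (fun _ : E4 ↦ A₀) 0 α β -
          upper (fun _ : E4 ↦ A₀) 0 α ν * upper (fun _ : E4 ↦ A₀) 0 μ β) +
      metricDet (fun _ : E4 ↦ A₀) 0 *
        ((upper (fun _ : E4 ↦ A₀) 0 * gram (fun _ : E4 ↦ X) 0 * upper (fun _ : E4 ↦ A₀) 0) μ ν *
            upper (fun _ : E4 ↦ A₀) 0 α β +
          upper (fun _ : E4 ↦ A₀) 0 μ ν *
            (upper (fun _ : E4 ↦ A₀) 0 * gram (fun _ : E4 ↦ X) 0 * upper (fun _ : E4 ↦ A₀) 0) α β -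
          (upper (fun _ : E4 ↦ A₀) 0 * gram (fun _ : E4 ↦ X) 0 * upper (fun _ : E4 ↦ A₀) 0) α ν *
            upper (fun _ : E4 ↦ A₀) 0 μ β -
          upper (fun _ : E4 ↦ A₀) 0 α ν *
            (upper (fun _ : E4 ↦ A₀) 0 * gram (fun _ : E4 ↦ X) 0 * upper (fun _ : E4 ↦ A₀) 0) μ β) := by
  -- abstract derivatives of the factors
  have hD : HasFDerivAt (fun A : E4 →L[ℝ] E4 →L[ℝ] ℝ ↦ metricDet (fun _ : E4 ↦ A) 0)
      (fderiv ℝ (fun A : E4 →L[ℝ] E4 →L[ℝ] ℝ ↦ metricDet (fun _ : E4 ↦ A) 0) A₀) A₀ :=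
    (differentiableAt_metricDet_const A₀).hasFDerivAt
  have hU : ∀ i j : Fin 4, HasFDerivAt (fun A : E4 →L[ℝ] E4 →L[ℝ] ℝ ↦ upper (fun _ : E4 ↦ A) 0 i j)
      (fderiv ℝ (fun A : E4 →L[ℝ] E4 →L[ℝ] ℝ ↦ upper (fun _ : E4 ↦ A) 0 i j) A₀) A₀ :=
    fun i j ↦ (differentiableAt_upper_const h₀ i j).hasFDerivAt
  have h1 := (hU μ ν).fun_mul (hU α β)
  have h2 := (hU α ν).fun_mul (hU μ β)
  have h3 := h1.fun_sub h2
  have h := (hD.fun_mul h3).fun_neg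
  have hfun : (fun A : E4 →L[ℝ] E4 →L[ℝ] ℝ ↦ superpotential (fun _ : E4 ↦ A) 0 μ α ν β) =
      fun A : E4 →L[ℝ] E4 →L[ℝ] ℝ ↦ -(metricDet (fun _ : E4 ↦ A) 0 *
        (upper (fun _ : E4 ↦ A) 0 μ ν * upper (fun _ : E4 ↦ A) 0 α β -
          upper (fun _ : E4 ↦ A) 0 α ν * upper (fun _ : E4 ↦ A) 0 μ β)) := by
    funext A
    simp only [superpotential, neg_mul]
  rw [hfun, h.fderiv]
  simp only [_root_.add_apply, _root_.sub_apply, _root_.smul_apply, _root_.neg_apply,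
    smul_eq_mul, fderiv_metricDet_const_apply h₀, fderiv_upper_const_apply h₀]
  ring

end Superpotential

end LandauLifshitz

end Literature.Geometry.Lorentzian
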